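import Literature.NumberTheory.LFunctions.WeilCombNodeWeightsMidpoint
import Mathlib.MeasureTheory.Function.JacobianOneDim
import Mathlib.MeasureTheory.Measure.Haar.NormedSpace
import Mathlib.MeasureTheory.Group.Integral
import Mathlib.Analysis.Complex.Exponential
import HarnessLib

/-!
# Node weights of `ζ`-mollified combs, II: one tooth sum in the dense regime

Topic `Literature/NumberTheory/LFunctions`.  For a `C²` bump autocorrelation `B` supported in
`[-2, 2]`, a window `0 < h ≤ 1/4` and a centre `c` in the DENSE regime `h e^c ≥ c₀` (many lattice
points `k` in the window `|log(e^c/k)| ≤ 2h`), the tooth sum over one progression of the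
mollifier is its integral up to a relative error `O((h e^c)^{-2})`:

* `abs_toothSum_sub_main_le` —
  `|∑_{k ≤ K} k^{-1/2} B((c - log k)/h) - h e^{c/2} β_h| ≤ C e^{-3c/2}/h`,
  `β_h = ∫ B(v) e^{-hv/2} dv`, `C = (N₀ + 2N₁ + N₂)(96 + 48/c₀)` (`N_i` bounds for `B, B', B''`),
  whenever the window lies below `K` (`e^{c+2h} ≤ K`) and `e^{c-2h} ≥ 4`;
* `integral_comp_exp_of_pos` (substitution `u = e^t`), `integral_exp_half_mul_bump`
  (`∫ e^{t/2} B((c-t)/h) dt = h e^{c/2} β_h`).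

Proof: midpoint rule (`Literature/NumberTheory/LFunctions/WeilCombNodeWeightsMidpoint.lean`) on the
`≤ 6 h e^c + 3` unit cells meeting the window, with `|f''| ≤ 64 (N₀ + 2N₁/h + N₂/h²) e^{-5c/2}`
there, and the exact evaluation of `∫ u^{-1/2} B((c - log u)/h) du` by `u = e^t`.
Everything is proved; no named facts.
-/

noncomputable section

open MeasureTheory Set intervalIntegral

namespace Literature.NumberTheory.LFunctions

/-! ## Two substitutions -/

/-- **Substitution `u = e^t` on an interval**: for `0 < A ≤ A'` and any `g`,
`∫_A^{A'} g(u) du = ∫_{log A}^{log A'} e^t g(e^t) dt` (Mathlib's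
`integral_Icc_deriv_smul_of_deriv_nonneg`; no integrability hypothesis). [folklore] -/
theorem integral_comp_exp_of_pos (g : ℝ → ℝ) {A A' : ℝ} (hA : 0 < A) (hAA' : A ≤ A') :
    ∫ u in A..A', g u = ∫ t in (Real.log A)..(Real.log A'), Real.exp t * g (Real.exp t) := by
  have hab : Real.log A ≤ Real.log A' := Real.log_le_log hA hAA'
  have hmain := MeasureTheory.integral_Icc_deriv_smul_of_deriv_nonneg (f := Real.exp)
    (f' := Real.exp) (g := g) Real.continuous_exp.continuousOn
    (fun x _ ↦ Real.hasDerivAt_exp x) (fun x _ ↦ (Real.exp_pos x).le) hab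
  rw [Real.exp_log hA, Real.exp_log (hA.trans_le hAA')] at hmain
  rw [intervalIntegral.integral_of_le hAA', intervalIntegral.integral_of_le hab,
    ← MeasureTheory.integral_Icc_eq_integral_Ioc, ← MeasureTheory.integral_Icc_eq_integral_Ioc,
    ← hmain]
  simp only [smul_eq_mul]

/-- **The tooth integral**: `∫ e^{t/2} B((c - t)/h) dt = h e^{c/2} ∫ B(v) e^{-hv/2} dv` for `h > 0`
(translate `t ↦ c - t`, dilate `t = hv`). [folklore] -/
theorem integral_exp_half_mul_bump (B : ℝ → ℝ) (c : ℝ) {h : ℝ} (hh : 0 < h) :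
    ∫ t, Real.exp (t / 2) * B ((c - t) / h)
      = h * Real.exp (c / 2) * ∫ v, B v * Real.exp (-(h * v) / 2) := by
  set G : ℝ → ℝ := fun t ↦ Real.exp (t / 2) * B ((c - t) / h) with hG
  have h1 : ∫ t, G t = ∫ t, Real.exp ((c - t) / 2) * B (t / h) := by
    have e1 : (fun s : ℝ ↦ Real.exp ((c - s) / 2) * B (s / h)) = fun s ↦ (fun y ↦ G (c + y)) ((-1 : ℝ) * s) := by
      funext s
      simp only [hG, neg_one_mul, ← sub_eq_add_neg, sub_sub_cancel]
    rw [e1, MeasureTheory.Measure.integral_comp_mul_left (fun y ↦ G (c + y)) (-1 : ℝ),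
      integral_add_left_eq_self G c]
    norm_num
  have h2 : (fun t ↦ Real.exp ((c - t) / 2) * B (t / h))
      = fun t ↦ (fun v ↦ Real.exp ((c - h * v) / 2) * B v) (h⁻¹ * t) := by
    funext t
    show _ = Real.exp ((c - h * (h⁻¹ * t)) / 2) * B (h⁻¹ * t)
    rw [mul_inv_cancel_left₀ hh.ne', inv_mul_eq_div]
  have h3 : (fun v ↦ Real.exp ((c - h * v) / 2) * B v)
      = fun v ↦ Real.exp (c / 2) * (B v * Real.exp (-(h * v) / 2)) := by
    funext v
    rw [show (c - h * v) / 2 = c / 2 + -(h * v) / 2 by ring, Real.exp_add]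
    ring
  rw [h1, h2, MeasureTheory.Measure.integral_comp_mul_left (fun v ↦ Real.exp ((c - h * v) / 2) * B v),
    inv_inv, abs_of_pos hh, smul_eq_mul, h3, MeasureTheory.integral_const_mul]
  ring

/-! ## The error constant -/

/-- Bookkeeping of the dense-regime error: `m D/4 ≤ (N₀+2N₁+N₂)(96+48/c₀) e^{-3c/2}/h` when
`m ≤ 6he^c + 3` cells, `D ≤ 64 N_h e^{-5c/2}`, `N_h = N₀ + 2N₁/h + N₂/h²`, `c₀ ≤ h e^c`, `0 < h ≤ 1`.
[folklore] -/
theorem dense_error_le {N₀ N₁ N₂ c₀ h c m D : ℝ} (hN₀ : 0 ≤ N₀) (hN₁ : 0 ≤ N₁) (hN₂ : 0 ≤ N₂)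
    (hh : 0 < h) (hh1 : h ≤ 1) (hc₀ : 0 < c₀) (hc₀h : c₀ ≤ h * Real.exp c)
    (hm : m ≤ 6 * h * Real.exp c + 3)
    (hD0 : 0 ≤ D) (hD : D ≤ 64 * (N₀ + 2 * N₁ / h + N₂ / h ^ 2) * Real.exp (-(5 * c / 2))) :
    m * (D / 4) ≤ (N₀ + 2 * N₁ + N₂) * (96 + 48 / c₀) * Real.exp (-(3 * c / 2)) / h := by
  set Nh : ℝ := N₀ + 2 * N₁ / h + N₂ / h ^ 2 with hNh
  have hNh0 : 0 ≤ Nh := by rw [hNh]; positivity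
  have hec : 0 < Real.exp c := Real.exp_pos c
  -- `e^{-5c/2} ≤ (h/c₀) e^{-3c/2}`
  have hec_inv : Real.exp (-(5 * c / 2)) ≤ h / c₀ * Real.exp (-(3 * c / 2)) := by
    have e1 : Real.exp (-(5 * c / 2)) = Real.exp (-c) * Real.exp (-(3 * c / 2)) := by
      rw [← Real.exp_add]; congr 1; ring
    rw [e1]
    refine mul_le_mul_of_nonneg_right ?_ (Real.exp_pos _).le
    rw [Real.exp_neg, inv_le_comm₀ hec (by positivity), inv_div]
    rwa [div_le_iff₀ hh, mul_comm]
  have e3 : 0 ≤ Real.exp (-(3 * c / 2)) := (Real.exp_pos _).le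
  have s1 : m * (D / 4) ≤ (6 * h * Real.exp c + 3) * (16 * Nh * Real.exp (-(5 * c / 2))) :=
    mul_le_mul hm (by linarith only [hD]) (by positivity) (by positivity)
  have e4 : Real.exp c * Real.exp (-(5 * c / 2)) = Real.exp (-(3 * c / 2)) := by
    rw [← Real.exp_add]; congr 1; ring
  have t1 : (6 * h * Real.exp c + 3) * (16 * Nh * Real.exp (-(5 * c / 2)))
      = 96 * Nh * h * Real.exp (-(3 * c / 2)) + 48 * Nh * Real.exp (-(5 * c / 2)) := by
    rw [← e4]; ring
  have t2 : 48 * Nh * Real.exp (-(5 * c / 2)) ≤ 48 * Nh * (h / c₀ * Real.exp (-(3 * c / 2))) :=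
    mul_le_mul_of_nonneg_left hec_inv (by positivity)
  have s2 : (6 * h * Real.exp c + 3) * (16 * Nh * Real.exp (-(5 * c / 2)))
      ≤ Nh * h * Real.exp (-(3 * c / 2)) * (96 + 48 / c₀) := by
    rw [t1]
    have t3 : 96 * Nh * h * Real.exp (-(3 * c / 2)) + 48 * Nh * (h / c₀ * Real.exp (-(3 * c / 2)))
        = Nh * h * Real.exp (-(3 * c / 2)) * (96 + 48 / c₀) := by ring
    linarith only [t2, t3]
  have s3 : Nh * h ≤ (N₀ + 2 * N₁ + N₂) / h := by
    rw [hNh, le_div_iff₀ hh]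
    have hh2 : h * h ≤ 1 := by nlinarith
    have q1 : N₀ * h * h ≤ N₀ := by
      have := mul_le_mul_of_nonneg_left hh2 hN₀
      calc N₀ * h * h = N₀ * (h * h) := by ring
        _ ≤ N₀ * 1 := this
        _ = N₀ := mul_one _
    have q2 : 2 * N₁ / h * h * h = 2 * N₁ * h := by field_simp
    have q3 : N₂ / h ^ 2 * h * h = N₂ := by field_simp
    have q4 : 2 * N₁ * h ≤ 2 * N₁ := by nlinarith
    calc (N₀ + 2 * N₁ / h + N₂ / h ^ 2) * h * h
        = N₀ * h * h + 2 * N₁ / h * h * h + N₂ / h ^ 2 * h * h := by ring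
      _ ≤ N₀ + 2 * N₁ + N₂ := by rw [q2, q3]; linarith only [q1, q4]
  have s4 : Nh * h * Real.exp (-(3 * c / 2)) * (96 + 48 / c₀)
      ≤ (N₀ + 2 * N₁ + N₂) / h * Real.exp (-(3 * c / 2)) * (96 + 48 / c₀) := by
    have hpos : 0 ≤ Real.exp (-(3 * c / 2)) * (96 + 48 / c₀) := by positivity
    have := mul_le_mul_of_nonneg_right s3 hpos
    calc Nh * h * Real.exp (-(3 * c / 2)) * (96 + 48 / c₀)
        = Nh * h * (Real.exp (-(3 * c / 2)) * (96 + 48 / c₀)) := by ring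
      _ ≤ (N₀ + 2 * N₁ + N₂) / h * (Real.exp (-(3 * c / 2)) * (96 + 48 / c₀)) := this
      _ = _ := by ring
  calc m * (D / 4) ≤ _ := s1
    _ ≤ _ := s2
    _ ≤ _ := s4
    _ = (N₀ + 2 * N₁ + N₂) * (96 + 48 / c₀) * Real.exp (-(3 * c / 2)) / h := by
        field_simp

/-! ## The dense regime -/

/-- **One tooth sum in the dense regime.** Let `B` be `C²` with `|B| ≤ N₀`, `|B'| ≤ N₁`, `|B''| ≤ N₂`
and `B(x) = 0` for `|x| > 2`; let `0 < h ≤ 1/4`, `0 < c₀ ≤ h e^c`, `e^{c-2h} ≥ 4` and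
`e^{c+2h} ≤ K`. Then
`|∑_{k=1}^{K} B((c - log k)/h)/√k - h e^{c/2} ∫ B(v) e^{-hv/2} dv| ≤ (N₀+2N₁+N₂)(96+48/c₀) e^{-3c/2}/h`.
[folklore] -/
theorem abs_toothSum_sub_main_le {B B' B'' : ℝ → ℝ} {N₀ N₁ N₂ c₀ h c : ℝ} {K : ℕ}
    (hB : ∀ x, HasDerivAt B (B' x) x) (hB' : ∀ x, HasDerivAt B' (B'' x) x)
    (h0 : ∀ x, |B x| ≤ N₀) (h1 : ∀ x, |B' x| ≤ N₁) (h2 : ∀ x, |B'' x| ≤ N₂)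
    (hBs : ∀ x, 2 < |x| → B x = 0)
    (hh : 0 < h) (hh4 : h ≤ 1 / 4) (hc₀ : 0 < c₀) (hc₀h : c₀ ≤ h * Real.exp c)
    (hc4 : 4 ≤ Real.exp (c - 2 * h)) (hK : Real.exp (c + 2 * h) ≤ K) :
    |∑ k ∈ Finset.Icc 1 K, B ((c - Real.log k) / h) / Real.sqrt k
        - h * Real.exp (c / 2) * ∫ v, B v * Real.exp (-(h * v) / 2)|
      ≤ (N₀ + 2 * N₁ + N₂) * (96 + 48 / c₀) * Real.exp (-(3 * c / 2)) / h := by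
  have hN₀ : 0 ≤ N₀ := (abs_nonneg _).trans (h0 0)
  have hN₁ : 0 ≤ N₁ := (abs_nonneg _).trans (h1 0)
  have hN₂ : 0 ≤ N₂ := (abs_nonneg _).trans (h2 0)
  have hh1 : h ≤ 1 := by linarith
  -- the window `[u₁, u₂]`
  set u₁ : ℝ := Real.exp (c - 2 * h) with hu₁
  set u₂ : ℝ := Real.exp (c + 2 * h) with hu₂
  have hu₁pos : 0 < u₁ := Real.exp_pos _
  have hu₁u₂ : u₁ ≤ u₂ := Real.exp_le_exp.2 (by linarith)
  -- the cells `a ≤ k ≤ b`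
  set a : ℕ := ⌊u₁⌋₊ with ha
  set b : ℕ := ⌈u₂⌉₊ with hb
  have ha_le : (a : ℝ) ≤ u₁ := Nat.floor_le hu₁pos.le
  have ha_gt : u₁ < a + 1 := Nat.lt_floor_add_one u₁
  have hb_ge : u₂ ≤ b := Nat.le_ceil u₂
  have hb_lt : (b : ℝ) < u₂ + 1 := Nat.ceil_lt_add_one (hu₁pos.le.trans hu₁u₂)
  have ha4 : 4 ≤ a := Nat.le_floor (by exact_mod_cast hc4)
  have ha4R : (4 : ℝ) ≤ a := by exact_mod_cast ha4
  have ha1 : 1 ≤ a := le_trans (by norm_num) ha4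
  have hab : a ≤ b := by
    have : (a : ℝ) ≤ b := ha_le.trans (hu₁u₂.trans hb_ge)
    exact_mod_cast this
  have hbK : b ≤ K := Nat.ceil_le.2 hK
  -- the summand as a function of a real variable
  set f : ℝ → ℝ := fun u ↦ Real.exp (-Real.log u / 2) * B ((c - Real.log u) / h) with hf
  have hfsqrt : ∀ u : ℝ, 0 < u → f u = B ((c - Real.log u) / h) / Real.sqrt u := by
    intro u hu
    simp only [hf]
    rw [exp_neg_log_half hu, inv_mul_eq_div]
  -- vanishing outside the window
  have hvan : ∀ k : ℕ, 1 ≤ k → ((k : ℝ) < u₁ ∨ u₂ < k) → B ((c - Real.log k) / h) = 0 := by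
    intro k hk hout
    apply hBs
    have hkpos : (0 : ℝ) < k := by exact_mod_cast hk
    rcases hout with hlt | hgt
    · have hlog : Real.log k < c - 2 * h := by
        rw [← Real.exp_lt_exp, Real.exp_log hkpos]; exact hlt
      have : 2 < (c - Real.log k) / h := by rw [lt_div_iff₀ hh]; linarith
      exact lt_of_lt_of_le this (le_abs_self _)
    · have hlog : c + 2 * h < Real.log k := by
        rw [← Real.exp_lt_exp, Real.exp_log hkpos]; exact hgt
      have : (c - Real.log k) / h < -2 := by rw [div_lt_iff₀ hh]; linarith
      have : 2 < -((c - Real.log k) / h) := by linarith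
      exact lt_of_lt_of_le this (neg_le_abs _)
  -- restrict the sum to the window cells
  have hsum : ∑ k ∈ Finset.Icc 1 K, B ((c - Real.log k) / h) / Real.sqrt k
      = ∑ k ∈ Finset.Icc a b, B ((c - Real.log k) / h) / Real.sqrt k := by
    symm
    apply Finset.sum_subset
    · intro k hk
      simp only [Finset.mem_Icc] at hk ⊢
      exact ⟨ha1.trans hk.1, hk.2.trans hbK⟩
    · intro k hk hk'
      simp only [Finset.mem_Icc, not_and_or, not_le] at hk hk'
      have hout : (k : ℝ) < u₁ ∨ u₂ < k := by
        rcases hk' with hlt | hlt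
        · left
          have : (k : ℝ) + 1 ≤ a := by exact_mod_cast hlt
          linarith
        · right
          have : (b : ℝ) + 1 ≤ k := by exact_mod_cast hlt
          linarith
      rw [hvan k hk.1 hout, zero_div]
  -- reindex over `range m`
  set m : ℕ := b + 1 - a with hm
  have hmR : (m : ℝ) = b + 1 - a := by
    rw [hm, Nat.cast_sub (by omega)]; push_cast; ring
  have hsum2 : ∑ k ∈ Finset.Icc a b, B ((c - Real.log k) / h) / Real.sqrt k
      = ∑ j ∈ Finset.range m, f ((a : ℝ) + j) := by
    rw [← Finset.Ico_add_one_right_eq_Icc, Finset.sum_Ico_eq_sum_range]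
    refine Finset.sum_congr rfl fun j _ ↦ ?_
    have hpos : (0 : ℝ) < (a : ℝ) + j := by
      have := j.cast_nonneg (α := ℝ); linarith
    rw [Nat.cast_add, hfsqrt _ hpos]
  -- derivatives of `f` on `u > 0`
  set Nh : ℝ := N₀ + 2 * N₁ / h + N₂ / h ^ 2 with hNh
  have hNh0 : 0 ≤ Nh := by rw [hNh]; positivity
  set F' : ℝ → ℝ := fun t ↦ Real.exp (-t / 2) * (-(B ((c - t) / h)) / 2 - B' ((c - t) / h) / h)
    with hF'
  set F'' : ℝ → ℝ := fun t ↦ Real.exp (-t / 2) *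
      (B ((c - t) / h) / 4 + B' ((c - t) / h) / h + B'' ((c - t) / h) / h ^ 2) with hF''
  set f' : ℝ → ℝ := fun u ↦ F' (Real.log u) * u⁻¹ with hf'
  set f'' : ℝ → ℝ := fun u ↦ (F'' (Real.log u) - F' (Real.log u)) / u ^ 2 with hf''
  have hfd : ∀ u, 0 < u → HasDerivAt f (f' u) u := fun u hu ↦
    hasDerivAt_comp_log hu (hasDerivAt_toothProfile hB c h (Real.log u))
  have hfd' : ∀ u, 0 < u → HasDerivAt f' (f'' u) u := fun u hu ↦
    hasDerivAt_comp_log_deriv hu (hasDerivAt_toothProfile_deriv hB hB' c h (Real.log u))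
  have hf''le : ∀ u, 0 < u → |f'' u| ≤ 2 * Nh * Real.exp (-Real.log u / 2) / u ^ 2 := by
    intro u hu
    show |(F'' (Real.log u) - F' (Real.log u)) / u ^ 2| ≤ _
    exact abs_comp_log_deriv2_le hu (abs_toothProfile_deriv_le h0 h1 hN₂ hh c (Real.log u))
      (abs_toothProfile_deriv2_le h0 h1 h2 hh c (Real.log u))
  -- the cell region `[A, b + 1/2]`, `A = a - 1/2`
  set A : ℝ := (a : ℝ) - 1 / 2 with hA
  have hA72 : (7 : ℝ) / 2 ≤ A := by rw [hA]; linarith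
  have hApos : 0 < A := by linarith
  have hAm : A + m = (b : ℝ) + 1 / 2 := by rw [hmR, hA]; ring
  -- the midpoint rule
  set D : ℝ := 2 * Nh * (Real.exp (-Real.log A / 2) / A ^ 2) with hD
  have hregion : ∀ x ∈ Icc ((a : ℝ) - 1 / 2) ((a : ℝ) - 1 / 2 + (m : ℝ)), 0 < x :=
    fun x hx ↦ hApos.trans_le hx.1
  have hmid := abs_sum_sub_integral_le (f := f) (f' := f') (f'' := f'') (D := D) (a := (a : ℝ)) m
    (fun x hx ↦ hfd x (hregion x hx)) (fun x hx ↦ hfd' x (hregion x hx))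
    (fun x hx ↦ (hf''le x (hregion x hx)).trans (by
      rw [hD, mul_div_assoc]
      exact mul_le_mul_of_nonneg_left (exp_neg_log_half_div_sq_le hApos hx.1) (by positivity)))
  -- the integral is the main term
  have hint : ∫ x in ((a : ℝ) - 1 / 2)..((a : ℝ) - 1 / 2 + m), f x
      = h * Real.exp (c / 2) * ∫ v, B v * Real.exp (-(h * v) / 2) := by
    rw [show (a : ℝ) - 1 / 2 = A from rfl, hAm]
    have hAb : A ≤ (b : ℝ) + 1 / 2 := by
      rw [← hAm]; have := m.cast_nonneg (α := ℝ); linarith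
    rw [integral_comp_exp_of_pos f hApos hAb]
    have hfun : ∀ t : ℝ, Real.exp t * f (Real.exp t) = Real.exp (t / 2) * B ((c - t) / h) := by
      intro t
      simp only [hf, Real.log_exp]
      have : Real.exp t * Real.exp (-t / 2) = Real.exp (t / 2) := by
        rw [← Real.exp_add]; congr 1; ring
      rw [← mul_assoc, this]
    simp_rw [hfun]
    rw [intervalIntegral.integral_eq_integral_of_support_subset]
    · exact integral_exp_half_mul_bump B c hh
    · intro t ht
      rw [Function.mem_support] at ht
      have hBt : B ((c - t) / h) ≠ 0 := by
        intro h0'; apply ht; rw [h0', mul_zero]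
      have habs : |(c - t) / h| ≤ 2 := by
        by_contra hcon; exact hBt (hBs _ (not_le.1 hcon))
      rw [abs_le, le_div_iff₀ hh, div_le_iff₀ hh] at habs
      constructor
      · have hAu₁ : A < u₁ := by rw [hA]; linarith
        have : Real.log A < c - 2 * h := by
          rw [Real.log_lt_iff_lt_exp hApos]; exact hAu₁
        linarith [habs.2]
      · have hpos : (0 : ℝ) < b + 1 / 2 := by
          have := Real.exp_pos (c + 2 * h); linarith [hb_ge]
        rw [Real.le_log_iff_exp_le hpos]
        calc Real.exp t ≤ Real.exp (c + 2 * h) := Real.exp_le_exp.2 (by linarith [habs.1])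
          _ ≤ b + 1 / 2 := by linarith [hb_ge]
  -- size of the window in cells: `m ≤ 6 h e^c + 3`
  have hexp2h : Real.exp (2 * h) ≤ 1 + 3 * h := by
    have hx : |2 * h| ≤ 1 := by rw [abs_of_pos (by linarith)]; linarith
    have := Real.abs_exp_sub_one_sub_id_le hx
    have h4 : (2 * h) ^ 2 ≤ h := by nlinarith
    linarith [(abs_le.1 this).2]
  have hexpm2h : 1 - 2 * h ≤ Real.exp (-(2 * h)) := by
    have := Real.add_one_le_exp (-(2 * h)); linarith
  have hu₂eq : u₂ = Real.exp c * Real.exp (2 * h) := by rw [hu₂, ← Real.exp_add]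
  have hu₁eq : u₁ = Real.exp c * Real.exp (-(2 * h)) := by
    rw [hu₁, sub_eq_add_neg, Real.exp_add]
  have hec : 0 < Real.exp c := Real.exp_pos c
  have hu₁ge : Real.exp c / 2 ≤ u₁ := by
    rw [hu₁eq]
    have : 1 / 2 ≤ Real.exp (-(2 * h)) := by linarith
    calc Real.exp c / 2 = Real.exp c * (1 / 2) := by ring
      _ ≤ Real.exp c * Real.exp (-(2 * h)) := mul_le_mul_of_nonneg_left this hec.le
  have hwin : u₂ - u₁ ≤ 5 * h * Real.exp c := by
    rw [hu₂eq, hu₁eq, ← mul_sub]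
    have : Real.exp (2 * h) - Real.exp (-(2 * h)) ≤ 5 * h := by linarith
    calc Real.exp c * (Real.exp (2 * h) - Real.exp (-(2 * h))) ≤ Real.exp c * (5 * h) :=
          mul_le_mul_of_nonneg_left this hec.le
      _ = 5 * h * Real.exp c := by ring
  have hm_le : (m : ℝ) ≤ 6 * h * Real.exp c + 3 := by
    rw [hmR]
    have : 0 ≤ h * Real.exp c := by positivity
    linarith
  -- size of `D`: `D ≤ 64 Nh e^{-5c/2}`
  have hAge : Real.exp (c - Real.log 4) ≤ A := by
    rw [Real.exp_sub, Real.exp_log (by norm_num : (0 : ℝ) < 4)]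
    have h1' : Real.exp c / 4 ≤ u₁ / 2 := by linarith
    have h2' : u₁ / 2 ≤ A := by rw [hA]; linarith
    exact h1'.trans h2'
  have hlogA : c - Real.log 4 ≤ Real.log A := by
    rw [Real.le_log_iff_exp_le hApos]; exact hAge
  have hsize : Real.exp (-Real.log A / 2) / A ^ 2 ≤ 32 * Real.exp (-(5 * c / 2)) := by
    have hA2 : A ^ 2 = Real.exp (2 * Real.log A) := by
      rw [show (2 : ℝ) * Real.log A = ((2 : ℕ) : ℝ) * Real.log A by norm_num, Real.exp_nat_mul,
        Real.exp_log hApos]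
    rw [hA2, ← Real.exp_sub]
    have hlog4 : Real.log 4 = 2 * Real.log 2 := by
      rw [show (4 : ℝ) = 2 ^ 2 by norm_num, Real.log_pow]; norm_num
    have h32 : (32 : ℝ) = Real.exp (5 * Real.log 2) := by
      rw [show (5 : ℝ) * Real.log 2 = ((5 : ℕ) : ℝ) * Real.log 2 by norm_num, Real.exp_nat_mul,
        Real.exp_log (by norm_num : (0 : ℝ) < 2)]
      norm_num
    rw [h32, ← Real.exp_add]
    apply Real.exp_le_exp.2
    rw [hlog4] at hlogA
    linarith
  have hD_le : D ≤ 64 * Nh * Real.exp (-(5 * c / 2)) := by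
    rw [hD]
    have := mul_le_mul_of_nonneg_left hsize (by positivity : (0 : ℝ) ≤ 2 * Nh)
    linarith
  -- assemble the error bound
  have hD0 : 0 ≤ D := by rw [hD]; positivity
  have herr : (m : ℝ) * (D / 4)
      ≤ (N₀ + 2 * N₁ + N₂) * (96 + 48 / c₀) * Real.exp (-(3 * c / 2)) / h :=
    dense_error_le hN₀ hN₁ hN₂ hh hh1 hc₀ hc₀h hm_le hD0 (by rw [hNh] at hD_le; exact hD_le)
  -- conclude
  rw [hsum, hsum2, ← hint]
  exact hmid.trans herr

end Literature.NumberTheory.LFunctions
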